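import Summits.BirchSwinnertonDyer.BirchSwinnertonDyer.Theorems.CMKolyvaginAtInertTwoPairCurrencyAtTwo
import HarnessLib

/-!
# Route `CMKolyvaginAtInertTwo`, crux `CMKolyvaginExactAtInertTwo` (stmt-BirchSwinnertonDyer-24277):
# THE ČEBOTAREV BINDER IS REFLECTED ALONG INJECTIVE COMPATIBLE MAPS (pure algebra)

Seat `bsd-line-cmk2-p1` g14 (cell `bsd-print-cf2`); helper (`--supports stmt-BirchSwinnertonDyer-24277`).
THEOREMS ONLY (pure algebra): no definition, no named fact, no `sorry`; no item is closed; BSD is not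
proved by this.

The order-form Čebotarev binder `hCeb₂` of the adaptive telescope
(`KolyvaginAdaptiveData.card_mul_card_le_of_casselsTate_adaptive`) is a property of a carrier `V` with
eigengroups `eig (±1)`, a collision group `Δ`, strict conditions `A ℓ` and a set of good primes: for a
finite pool `T` of pure classes and pure `g₁ ∈ V^{ν}`, `g₂ ∈ V^{−ν}` whose bottoms avoid `Δ + ⟨T⟩`
(`H1`, `H2`), there are arbitrarily large good `ℓ` with `⟨T⟩ ≤ A ℓ`, `2^j g₁ ∉ A ℓ (j < e₁)`,
`2^i g₂ ∉ A ℓ (i < I)`. THIS FILE: if `f : V' → V` is an INJECTIVE additive map and `eig'`, `Δ'`,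
`A' ℓ` (at good `ℓ`) are the preimages of `eig`, `Δ`, `A ℓ`, then the binder for `V` implies the binder
for `V'` (`binder_of_injective`). The tree's binder lives on `V = H¹(K,E[2^M])^{ε} × H¹(K,E[2^M])^{−ε}`
(`cebotarev_binder_pair`, p671475; depth `M+1`: `cebotarev_binder_pair_succ`, p688445, itself an
instance of this transfer along `ι_*`); the transfer serves the carriers of the T2 design
(KERNEL-STATUS §13.2/§13.8): the `ℚ`-Selmer sub-carrier, or the `ℚ`-pair carrier
`H¹(ℚ,E[2^M]) × H¹(ℚ,E^{(d_K)}[2^M])` of the `GenusKolyvaginAtTwo` lineage mapped in by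
`(res, hPsiKT ∘ res)` (injective for `E(K)[2] = 0`; its collision group `ker(rK₁ + rK₂)` is the preimage
of `pairDelta` — the `2`-torsion-tolerant replacement of that lineage's uninhabited `sel_visible`,
cf. `…VisiblePairAtTwoH2Vacuity`).

* `binder_of_injective` — the transfer theorem.

References: [McCallumLMS1991] §3 Prop. 3.1, Cor. 3.2, §5 Thm. 5.4 (21)–(23); [Kolyvagin1989Izv] §3.
-/

-- single-conjunct summit: `Summit.BirchSwinnertonDyer.BirchSwinnertonDyer.…` repeats the name by design
set_option linter.dupNamespace false
set_option autoImplicit false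

namespace Summit.BirchSwinnertonDyer.BirchSwinnertonDyer.Theorems.KolyvaginPairDataTwo

/-- **The Čebotarev binder is reflected along an injective compatible map.** `f : V' →+ V` injective;
`eig' e = f⁻¹(eig e)`, `Δ' = f⁻¹(Δ)`, and `A' ℓ = f⁻¹(A ℓ)` at good `ℓ`; then the order-form binder for
`(V, eig, Δ, A, Good)` implies the one for `(V', eig', Δ', A', Good)`.
[cite: McCallumLMS1991, §3 Prop. 3.1, Cor. 3.2; §5 Thm. 5.4 (21)–(23)] -/
theorem binder_of_injective {V V' : Type*} [AddCommGroup V] [AddCommGroup V'] (f : V' →+ V)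
    (hf : Function.Injective f)
    (eig : ℤ → AddSubgroup V) (Δ : AddSubgroup V) (A : ℕ → AddSubgroup V) (Good : ℕ → Prop)
    (eig' : ℤ → AddSubgroup V') (Δ' : AddSubgroup V') (A' : ℕ → AddSubgroup V')
    (heig : ∀ e v, v ∈ eig' e ↔ f v ∈ eig e) (hΔ : ∀ v, v ∈ Δ' ↔ f v ∈ Δ)
    (hA : ∀ ℓ, Good ℓ → ∀ v, v ∈ A' ℓ ↔ f v ∈ A ℓ)
    (hB : ∀ (T : Finset V) (g₁ g₂ : V) (ν : ℤ) (I e₁ : ℕ), (ν = 1 ∨ ν = -1) →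
      g₁ ∈ eig ν → g₂ ∈ eig (-ν) → (∀ t ∈ T, ∃ e : ℤ, (e = 1 ∨ e = -1) ∧ t ∈ eig e) →
      addOrderOf g₁ = 2 ^ e₁ →
      (g₁ ≠ 0 → (((2 : ℕ) : ℤ) ^ (e₁ - 1)) • g₁ ∉ Δ ⊔ AddSubgroup.closure (T : Set V)) →
      (1 ≤ I → ∀ d ∈ Δ, ∀ u ∈ AddSubgroup.closure (T : Set V), u ∈ eig (-ν) →
        ∀ v ∈ AddSubgroup.closure (T : Set V), v ∈ eig ν → ((2 : ℕ) : ℤ) • v = 0 →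
        (((2 : ℕ) : ℤ) ^ (I - 1)) • g₂ ≠ d + u + v) →
      ∀ b₀ : ℕ, ∃ ℓ : ℕ, b₀ < ℓ ∧ Good ℓ ∧ (∀ t ∈ AddSubgroup.closure (T : Set V), t ∈ A ℓ) ∧
        (∀ j < e₁, (((2 : ℕ) : ℤ) ^ j) • g₁ ∉ A ℓ) ∧ (∀ i < I, (((2 : ℕ) : ℤ) ^ i) • g₂ ∉ A ℓ))
    (T : Finset V') (g₁ g₂ : V') (ν : ℤ) (I e₁ : ℕ) (hν : ν = 1 ∨ ν = -1)
    (hg₁ : g₁ ∈ eig' ν) (hg₂ : g₂ ∈ eig' (-ν))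
    (hT : ∀ t ∈ T, ∃ e : ℤ, (e = 1 ∨ e = -1) ∧ t ∈ eig' e)
    (he₁ : addOrderOf g₁ = 2 ^ e₁)
    (H1 : g₁ ≠ 0 → (((2 : ℕ) : ℤ) ^ (e₁ - 1)) • g₁ ∉ Δ' ⊔ AddSubgroup.closure (T : Set V'))
    (H2 : 1 ≤ I → ∀ d ∈ Δ', ∀ u ∈ AddSubgroup.closure (T : Set V'), u ∈ eig' (-ν) →
      ∀ v ∈ AddSubgroup.closure (T : Set V'), v ∈ eig' ν → ((2 : ℕ) : ℤ) • v = 0 →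
      (((2 : ℕ) : ℤ) ^ (I - 1)) • g₂ ≠ d + u + v)
    (b₀ : ℕ) :
    ∃ ℓ : ℕ, b₀ < ℓ ∧ Good ℓ ∧ (∀ t ∈ AddSubgroup.closure (T : Set V'), t ∈ A' ℓ) ∧
      (∀ j < e₁, (((2 : ℕ) : ℤ) ^ j) • g₁ ∉ A' ℓ) ∧ (∀ i < I, (((2 : ℕ) : ℤ) ^ i) • g₂ ∉ A' ℓ) := by
  classical
  -- ### the transferred data
  have hclos : AddSubgroup.closure ((T.image f : Finset V) : Set V) =
      (AddSubgroup.closure (T : Set V')).map f := by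
    rw [Finset.coe_image, AddMonoidHom.map_closure]
  have hT' : ∀ t ∈ T.image f, ∃ e : ℤ, (e = 1 ∨ e = -1) ∧ t ∈ eig e := by
    intro t ht
    obtain ⟨s, hs, rfl⟩ := Finset.mem_image.mp ht
    obtain ⟨e, he, hse⟩ := hT s hs
    exact ⟨e, he, (heig e s).mp hse⟩
  have hg₁' : f g₁ ∈ eig ν := (heig ν g₁).mp hg₁
  have hg₂' : f g₂ ∈ eig (-ν) := (heig (-ν) g₂).mp hg₂
  have he₁' : addOrderOf (f g₁) = 2 ^ e₁ := by rw [addOrderOf_injective f hf, he₁]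
  have H1' : f g₁ ≠ 0 → (((2 : ℕ) : ℤ) ^ (e₁ - 1)) • f g₁ ∉
      Δ ⊔ AddSubgroup.closure ((T.image f : Finset V) : Set V) := by
    intro hne hmem
    have hne0 : g₁ ≠ 0 := fun h ↦ hne (by rw [h, map_zero])
    rw [hclos] at hmem
    obtain ⟨d', hd', w', hw', hsum⟩ := AddSubgroup.mem_sup.mp hmem
    obtain ⟨w, hw, rfl⟩ := AddSubgroup.mem_map.mp hw'
    have hd'eq : d' = f ((((2 : ℕ) : ℤ) ^ (e₁ - 1)) • g₁ - w) := by
      rw [map_sub, map_zsmul, ← hsum, add_sub_cancel_right]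
    have hd : (((2 : ℕ) : ℤ) ^ (e₁ - 1)) • g₁ - w ∈ Δ' := by
      rw [hΔ, ← hd'eq]
      exact hd'
    exact H1 hne0 (AddSubgroup.mem_sup.mpr ⟨_, hd, w, hw, sub_add_cancel _ _⟩)
  have H2' : 1 ≤ I → ∀ d' ∈ Δ, ∀ u' ∈ AddSubgroup.closure ((T.image f : Finset V) : Set V),
      u' ∈ eig (-ν) → ∀ v' ∈ AddSubgroup.closure ((T.image f : Finset V) : Set V), v' ∈ eig ν →
      ((2 : ℕ) : ℤ) • v' = 0 → (((2 : ℕ) : ℤ) ^ (I - 1)) • f g₂ ≠ d' + u' + v' := by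
    intro hI d' hd' u' hu' hu'ν v' hv' hv'ν h2v' heq
    rw [hclos] at hu' hv'
    obtain ⟨u, hu, rfl⟩ := AddSubgroup.mem_map.mp hu'
    obtain ⟨v, hv, rfl⟩ := AddSubgroup.mem_map.mp hv'
    have huν : u ∈ eig' (-ν) := (heig (-ν) u).mpr hu'ν
    have hvν : v ∈ eig' ν := (heig ν v).mpr hv'ν
    have h2v : ((2 : ℕ) : ℤ) • v = 0 := by
      apply hf
      rw [map_zsmul, h2v', map_zero]
    have hd'eq : d' = f ((((2 : ℕ) : ℤ) ^ (I - 1)) • g₂ - u - v) := by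
      rw [map_sub, map_sub, map_zsmul, heq]; abel
    have hd : (((2 : ℕ) : ℤ) ^ (I - 1)) • g₂ - u - v ∈ Δ' := by
      rw [hΔ, ← hd'eq]
      exact hd'
    exact H2 hI _ hd u hu huν v hv hvν h2v (by abel)
  -- ### the binder on `V`, pulled back
  obtain ⟨ℓ, hbℓ, hgood, hpool, hfull, hge⟩ :=
    hB (T.image f) (f g₁) (f g₂) ν I e₁ hν hg₁' hg₂' hT' he₁' H1' H2' b₀
  refine ⟨ℓ, hbℓ, hgood, ?_, ?_, ?_⟩
  · intro t ht
    rw [hA ℓ hgood]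
    exact hpool (f t) (by rw [hclos]; exact AddSubgroup.mem_map_of_mem f ht)
  · intro j hj hmem
    refine hfull j hj ?_
    rw [← map_zsmul, ← hA ℓ hgood]
    exact hmem
  · intro i hi hmem
    refine hge i hi ?_
    rw [← map_zsmul, ← hA ℓ hgood]
    exact hmem

end Summit.BirchSwinnertonDyer.BirchSwinnertonDyer.Theorems.KolyvaginPairDataTwo
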